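import Literature.Computability.AlgebraicComplexity.StrassenPreorderMaximal
import Literature.Computability.AlgebraicComplexity.StrassenPreorderHom
import HarnessLib

/-!
# Strassen's spectral theorem: `a ≲ b ⟺ ∀ φ ∈ X, φ(a) ≤ φ(b)` (Zuiddam 2018, Thm. 2.12; Strassen 1988, Thm. 2.4)

Topic `Literature/Computability/AlgebraicComplexity`; part of the abstract theory of asymptotic
spectra (`StrassenPreorder.lean`: Strassen preorders `≼`, spectral points; `…Closure.lean`: the
asymptotic preorder `≼~ = AsympLe` and Lemmas 2.3, 2.4 (i), (ii), (iv); `…Maximal.lean`: the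
extension lemma 2.5 and Zorn; `…Hom.lean`: Lemma 2.9, spectral points of total preorders).
This file proves

* `IsStrassenPreorder.asympLe_of_asympLe_asympLe` — **Zuiddam Lemma 2.4 (iii)**: `a ≼~~ b ⇒ a ≼~ b`
  (the asymptotic preorder is asymptotically closed). Proof: from `a^N ≼~ x_N b^N` pick one good
  exponent `N` (with `x_N` small) and its subexponential sequence `y`; the *minimal* admissible
  factors `f(L) = min {z : a^L ≼ z b^L}` then satisfy `f(qN + r) ≤ y(q) x_N^q f(r)`, which is
  subexponential in `L = qN + r`.
* `IsStrassenPreorder.exists_spectralPoint_lt_of_not_asympLe` — the hard direction of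
  **Zuiddam Thm. 2.12** (via Lemma 2.11): if `¬ a ≼~ b` then some spectral point has `φ(b) < φ(a)`.
  Proof: by 2.4 (i), (ii), (iv) and (iii) applied to the Strassen preorder `≼~`, some `n` admits no
  relation `m + 1 + s·(n a) ≼~ m + s·(n b + 1)`; the extension lemma then gives a Strassen preorder
  `≼' ⊇ ≼~ ⊇ ≼` with `n b + 1 ≼' n a`, and a spectral point of `≼'` (Lemma 2.9 after Zorn) is a
  spectral point of `≼` with `n φ(b) + 1 ≤ n φ(a)`.
* `IsStrassenPreorder.asympLe_iff_forall_spectralPoint` — **Thm. 2.12**: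
  `a ≼~ b ↔ ∀ φ ∈ X(S, ≼), φ(a) ≤ φ(b)`.

## References

* J. Zuiddam, *Algebraic complexity, asymptotic spectra and entanglement polytopes*, PhD thesis
  (2018), Lemma 2.4, Lemma 2.5, Lemma 2.11, Thm. 2.12 (pp. 22–26). [Zuiddam2018]
* V. Strassen, *The asymptotic spectrum of tensors*, J. reine angew. Math. 384 (1988), Thm. 2.4.
  [Strassen1988]
-/

noncomputable section

open scoped BigOperators

namespace Literature.Computability.AlgebraicComplexity

universe u

variable {S : Type u} [CommSemiring S]

namespace IsStrassenPreorder

variable {le : S → S → Prop}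

/-! ## Lemma 2.4 (iii): `≼~~ ⊆ ≼~` -/

/-- Powers of a non-zero element are non-zero (`1 ≼ r b` gives `1 ≼ r^L b^L`). [cite: Zuiddam2018, §2.3] -/
theorem pow_ne_zero' (h : IsStrassenPreorder le) {b : S} (hb : b ≠ 0) (L : ℕ) : b ^ L ≠ 0 := by
  intro h0
  obtain ⟨r, hr⟩ := h.exists_one_le_natCast_mul hb
  have := h.pow_le_pow hr L
  rw [one_pow, mul_pow, h0, mul_zero] at this
  exact h.one_ne_zero (by
    have h10 : le ((1 : ℕ) : S) ((0 : ℕ) : S) := by simpa using this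
    have := (h.natCast_le_iff 1 0).1 h10
    omega)

/-- If `a ≼ 0` then `a ≼~ b` for every `b` (indeed `a^L ≼ 0 ≼ b^L` for `L ≥ 1`). [cite: Zuiddam2018, Lemma 2.4] -/
theorem asympLe_of_le_zero (h : IsStrassenPreorder le) {a : S} (ha : le a 0) (b : S) :
    AsympLe le a b := by
  refine ⟨fun _ => 1, IsSubexponential.const 1, fun L => ?_⟩
  rcases L with _ | L
  · simpa using h.refl 1
  · have : le (a ^ (L + 1)) 0 := by simpa using h.pow_le_pow ha (L + 1)
    exact h.trans this (by simpa using h.zero_le _)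

/-- **Zuiddam Lemma 2.4 (iii)**: the asymptotic preorder of `≼~` is `≼~` itself,
`a ≼~~ b ⇒ a ≼~ b`. [cite: Zuiddam2018, Lemma 2.4] -/
theorem asympLe_of_asympLe_asympLe (h : IsStrassenPreorder le) {a b : S}
    (hab : AsympLe (AsympLe le) a b) : AsympLe le a b := by
  classical
  obtain ⟨x, hx, hxab⟩ := hab
  by_cases hb : b = 0
  · -- `b = 0`: `a ≼ 0` from the exponents `N = M = 1`
    subst hb
    obtain ⟨y, -, hy⟩ := hxab 1
    have h1 := hy 1
    simp only [pow_one, mul_zero] at h1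
    exact h.asympLe_of_le_zero h1 0
  -- admissible factors exist for every exponent
  have hex : ∀ L : ℕ, ∃ z : ℕ, le (a ^ L) ((z : S) * b ^ L) := fun L =>
    h.exists_le_natCast_mul _ (h.pow_ne_zero' hb L)
  -- the minimal admissible factors
  set f : ℕ → ℕ := fun L => Nat.find (hex L) with hf
  have hfle : ∀ L, le (a ^ L) ((f L : S) * b ^ L) := fun L => Nat.find_spec (hex L)
  have hfmin : ∀ L (z : ℕ), le (a ^ L) ((z : S) * b ^ L) → f L ≤ z := fun L z hz =>
    Nat.find_min' (hex L) hz
  refine ⟨f, ?_, hfle⟩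
  -- `f` is subexponential
  intro ε hε
  -- rates: `(1 + ε₁)^2 ≤ 1 + ε`, `(1 + ε₂)^2 ≤ 1 + ε₁`
  set ε₁ : ℝ := ε / (2 + ε) with hε₁
  have hε₁0 : 0 < ε₁ := by positivity
  have hsq₁ : (1 + ε₁) * (1 + ε₁) ≤ 1 + ε := by
    have h2 : (0 : ℝ) < 2 + ε := by positivity
    have : 1 + ε₁ = (2 + 2 * ε) / (2 + ε) := by rw [hε₁]; field_simp; ring
    rw [this, div_mul_div_comm, div_le_iff₀ (by positivity)]
    nlinarith [mul_nonneg (mul_nonneg hε.le hε.le) hε.le, sq_nonneg ε]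
  set ε₂ : ℝ := ε₁ / (2 + ε₁) with hε₂
  have hε₂0 : 0 < ε₂ := by positivity
  have hsq₂ : (1 + ε₂) * (1 + ε₂) ≤ 1 + ε₁ := by
    have h2 : (0 : ℝ) < 2 + ε₁ := by positivity
    have : 1 + ε₂ = (2 + 2 * ε₁) / (2 + ε₁) := by rw [hε₂]; field_simp; ring
    rw [this, div_mul_div_comm, div_le_iff₀ (by positivity)]
    nlinarith [mul_nonneg (mul_nonneg hε₁0.le hε₁0.le) hε₁0.le, sq_nonneg ε₁]
  -- a good exponent `N ≥ 1` with `x N ≤ (1 + ε₂)^(2N)`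
  obtain ⟨Cx, hCx⟩ := hx ε₂ hε₂0
  obtain ⟨n₀, hn₀⟩ := pow_unbounded_of_one_lt Cx (by linarith : (1 : ℝ) < 1 + ε₂)
  set N : ℕ := n₀ + 1 with hN
  have hN1 : 1 ≤ N := Nat.succ_le_succ (Nat.zero_le _)
  have hxN : (x N : ℝ) ≤ ((1 + ε₂) ^ N) * (1 + ε₂) ^ N := by
    refine (hCx N).trans (mul_le_mul_of_nonneg_right ?_ (by positivity))
    exact hn₀.le.trans (pow_le_pow_right₀ (by linarith) (Nat.le_succ _))
  -- its subexponential sequence `y`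
  obtain ⟨y, hy, hyN⟩ := hxab N
  obtain ⟨Cy, hCy⟩ := hy ε₁ hε₁0
  have hCy0 : 0 ≤ Cy := by
    have := hCy 0; simp at this; exact (Nat.cast_nonneg _).trans this
  -- the constant: `Cy * max_{r < N} f r`
  set M₀ : ℕ := (Finset.range N).sup f with hM₀
  refine ⟨Cy * M₀, fun L => ?_⟩
  -- write `L = q N + r`
  set q := L / N with hq
  set r := L % N with hr
  have hL : L = N * q + r := (Nat.div_add_mod L N).symm
  have hrN : r < N := Nat.mod_lt _ hN1
  -- `f L ≤ y q * x N ^ q * f r`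
  have hchain : le (a ^ L) (((y q * x N ^ q * f r : ℕ) : S) * b ^ L) := by
    have h1 : le ((a ^ N) ^ q) ((y q : S) * ((x N : S) * b ^ N) ^ q) := hyN q
    have h2 : le (a ^ r) ((f r : S) * b ^ r) := hfle r
    have h3 := h.mul_le_mul h1 h2
    have e1 : a ^ L = (a ^ N) ^ q * a ^ r := by rw [hL, pow_add, pow_mul]
    have e2 : ((y q * x N ^ q * f r : ℕ) : S) * b ^ L =
        (y q : S) * ((x N : S) * b ^ N) ^ q * ((f r : S) * b ^ r) := by
      rw [hL]; push_cast; ring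
    rw [e1, e2]
    exact h3
  have hfL : f L ≤ y q * x N ^ q * f r := hfmin L _ hchain
  -- numerical bounds
  have hq_le : q ≤ L := Nat.div_le_self L N
  have hNq_le : N * q ≤ L := by rw [hL]; exact Nat.le_add_right _ _
  have h1ε₁ : (1 : ℝ) ≤ 1 + ε₁ := by linarith
  have h1ε₂ : (1 : ℝ) ≤ 1 + ε₂ := by linarith
  have hyq : (y q : ℝ) ≤ Cy * (1 + ε₁) ^ L :=
    (hCy q).trans (mul_le_mul_of_nonneg_left (pow_le_pow_right₀ h1ε₁ hq_le) hCy0)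
  have hxq : ((x N ^ q : ℕ) : ℝ) ≤ (1 + ε₁) ^ L := by
    push_cast
    calc (x N : ℝ) ^ q ≤ (((1 + ε₂) ^ N) * (1 + ε₂) ^ N) ^ q :=
          pow_le_pow_left₀ (Nat.cast_nonneg _) hxN q
      _ = ((1 + ε₂) * (1 + ε₂)) ^ (N * q) := by rw [← mul_pow, pow_mul]
      _ ≤ (1 + ε₁) ^ (N * q) := pow_le_pow_left₀ (by positivity) hsq₂ _
      _ ≤ (1 + ε₁) ^ L := pow_le_pow_right₀ h1ε₁ hNq_le
  have hfr : (f r : ℝ) ≤ M₀ := by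
    exact_mod_cast Finset.le_sup (f := f) (Finset.mem_range.2 hrN)
  calc (f L : ℝ) ≤ ((y q * x N ^ q * f r : ℕ) : ℝ) := by exact_mod_cast hfL
    _ = (y q : ℝ) * ((x N ^ q : ℕ) : ℝ) * (f r : ℝ) := by push_cast; ring
    _ ≤ (Cy * (1 + ε₁) ^ L) * (1 + ε₁) ^ L * M₀ := by
        refine _root_.mul_le_mul (_root_.mul_le_mul hyq hxq (by positivity) (by positivity)) hfr
          (by positivity) (by positivity)
    _ = Cy * M₀ * ((1 + ε₁) * (1 + ε₁)) ^ L := by rw [mul_pow]; ring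
    _ ≤ Cy * M₀ * (1 + ε) ^ L :=
        mul_le_mul_of_nonneg_left (pow_le_pow_left₀ (by positivity) hsq₁ L) (by positivity)

/-! ## Lemma 2.11 / Theorem 2.12 -/

/-- From `∀ n, n a ≼~ n b + 1` conclude `a ≼~ b` (Zuiddam Lemma 2.4 (iv) with `s = 1`, for the
Strassen preorder `≼~`, followed by Lemma 2.4 (iii)). [cite: Zuiddam2018, Lemma 2.4] -/
theorem asympLe_of_forall_natCast_mul_asympLe_add_one (h : IsStrassenPreorder le) {a b : S}
    (H : ∀ n : ℕ, AsympLe le ((n : S) * a) ((n : S) * b + 1)) : AsympLe le a b := by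
  have h' := h.asympLe
  by_cases hb : b = 0
  · subst hb
    -- `n a ≼~ 1` for all `n` forces `a = 0`
    suffices ha : a = 0 by subst ha; exact h'.zero_le 0
    by_contra ha
    obtain ⟨r, hr⟩ := h.exists_one_le_natCast_mul ha
    refine h'.not_forall_natCast_le (r : S) fun n => ?_
    have s1 : le ((n : S) * 1) ((n : S) * ((r : S) * a)) := h.mul_left _ hr
    have s2 : AsympLe le ((r : S) * ((n : S) * a)) ((r : S) * ((n : S) * 0 + 1)) :=
      h'.mul_left _ (H n)
    have e1 : (n : S) * ((r : S) * a) = (r : S) * ((n : S) * a) := by ring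
    rw [mul_one, e1] at s1
    rw [mul_zero, zero_add, mul_one] at s2
    exact h'.trans (h.asympLe_of_le s1) s2
  · obtain ⟨k, hk⟩ := h.exists_one_le_natCast_mul hb
    refine h.asympLe_of_asympLe_asympLe (h'.asympLe_of_forall_natCast_mul_le k fun n => ?_)
    have s1 : AsympLe le ((n : S) * b + 1) ((n : S) * b + (k : S) * b) :=
      h'.add_left _ (h.asympLe_of_le hk)
    have e : ((n + k : ℕ) : S) * b = (n : S) * b + (k : S) * b := by push_cast; ring
    rw [e]
    exact h'.trans (H n) s1

/-- **The hard direction of the spectral theorem** (Zuiddam 2018, Lemma 2.11 ⇒ Thm. 2.12;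
Strassen 1988, Thm. 2.4): if `¬ (a ≼~ b)` then there is a spectral point `φ ∈ X(S, ≼)` with
`φ(b) < φ(a)`. [cite: Zuiddam2018, Thm. 2.12] -/
theorem exists_spectralPoint_lt_of_not_asympLe (h : IsStrassenPreorder le) {a b : S}
    (hab : ¬ AsympLe le a b) : ∃ φ, IsSpectralPoint le φ ∧ φ b < φ a := by
  have h' := h.asympLe
  -- some `n` admits no relation `m + 1 + s (n a) ≼~ m + s (n b + 1)`
  have key : ∃ n : ℕ, ∀ (s : S) (m : ℕ),
      ¬ AsympLe le ((m : S) + 1 + s * ((n : S) * a)) ((m : S) + s * ((n : S) * b + 1)) := by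
    by_contra hcon
    push Not at hcon
    refine hab (h.asympLe_of_forall_natCast_mul_asympLe_add_one fun n => ?_)
    obtain ⟨s, m, hsm⟩ := hcon n
    -- `s ≠ 0`, otherwise `m + 1 ≼~ m`
    have hs : s ≠ 0 := by
      rintro rfl
      simp only [zero_mul, add_zero] at hsm
      have := (h'.natCast_le_iff (m + 1) m).1 (by push_cast; exact hsm)
      omega
    -- additive cancellation of `m` (2.4 (i) for `≼~`, then (iii))
    have h1 : AsympLe le (1 + s * ((n : S) * a)) (s * ((n : S) * b + 1)) := by
      refine h.asympLe_of_asympLe_asympLe (h'.asympLe_of_add_le (b := (m : S)) ?_)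
      have e1 : 1 + s * ((n : S) * a) + (m : S) = (m : S) + 1 + s * ((n : S) * a) := by ring
      have e2 : s * ((n : S) * b + 1) + (m : S) = (m : S) + s * ((n : S) * b + 1) := by ring
      rw [e1, e2]
      exact hsm
    -- drop the `1` and cancel `s` (2.4 (ii) for `≼~`, then (iii))
    have h2 : AsympLe le (s * ((n : S) * a)) (s * ((n : S) * b + 1)) :=
      h'.trans (h'.le_add_left _ _) h1
    refine h.asympLe_of_asympLe_asympLe (h'.asympLe_of_mul_le hs ?_)
    rw [mul_comm ((n : S) * a) s, mul_comm ((n : S) * b + 1) s]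
    exact h2
  obtain ⟨n, hn⟩ := key
  -- extend `≼~` by `n b + 1 ≼' n a`
  obtain ⟨le', hle', himp, hrel⟩ := h'.exists_extension (a₁ := (n : S) * b + 1)
    (a₂ := (n : S) * a) hn
  -- a spectral point of `≼'` is one of `≼`
  obtain ⟨φ, hφ, hφ'⟩ := h.exists_isSpectralPoint_of_imp hle'
    (fun x y hxy => himp x y (h.asympLe_of_le hxy))
  refine ⟨φ, hφ, ?_⟩
  have hmono := hφ'.mono hrel
  rw [hφ'.map_add, hφ'.map_mul, hφ'.map_mul, hφ'.map_natCast, hφ'.map_one] at hmono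
  have hn0 : (0 : ℝ) ≤ n := Nat.cast_nonneg n
  nlinarith

/-- **Strassen's spectral theorem** (Zuiddam 2018, Thm. 2.12 = Strassen 1988, Thm. 2.4): for a
commutative semiring with a Strassen preorder `≼`, `a ≼~ b` iff `φ(a) ≤ φ(b)` for every
`≼`-monotone semiring homomorphism `φ : S → ℝ≥0`. [cite: Zuiddam2018, Thm. 2.12] -/
theorem asympLe_iff_forall_spectralPoint (h : IsStrassenPreorder le) {a b : S} :
    AsympLe le a b ↔ ∀ φ, IsSpectralPoint le φ → φ a ≤ φ b := by
  constructor
  · rintro ⟨f, hf, hle⟩ φ hφ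
    refine hf.le_of_pow_le (hφ.nonneg h b) fun N _ => ?_
    have := hφ.mono (hle N)
    rwa [hφ.map_pow, hφ.map_mul, hφ.map_natCast, hφ.map_pow] at this
  · intro H
    by_contra hab
    obtain ⟨φ, hφ, hlt⟩ := h.exists_spectralPoint_lt_of_not_asympLe hab
    exact absurd (H φ hφ) (not_le.2 hlt)

/-- The hard direction in the form consumed by `StrassenPreorderSubrank.lean` (`hspec`). [cite: Zuiddam2018, Thm. 2.12] -/
theorem asympLe_of_forall_spectralPoint (h : IsStrassenPreorder le) (a b : S)
    (H : ∀ φ, IsSpectralPoint le φ → φ a ≤ φ b) : AsympLe le a b :=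
  (h.asympLe_iff_forall_spectralPoint).2 H

end IsStrassenPreorder

end Literature.Computability.AlgebraicComplexity

end
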